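import Mathlib.Computability.Halting
import Literature.Computability.Complexity.BakerGillSolovay
import Literature.Computability.Complexity.OracleAlgEnumeration
import Literature.Computability.MetaComplexity.KolmogorovProofs
import HarnessLib

/-!
# The Baker–Gill–Solovay oracle `A` with `P^A = NP^A` is recursive

`BakerGillSolovay.lean` constructs, for ANY sequence `e : ℕ → OracleAlg Bool` of oracle
algorithms, Ko's fixed point `A = K(A)` (`BGS.oracleA e`; Ko 1989, §5, p. 21: "whether
an instance `x = ⟨0^i, a, 0^j⟩` is in `K(A)` depends only on the set `A_{<|x|}`") and proves
`NP^A ⊆ P^A` as soon as `e` contains every polynomial-time oracle algorithm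
(`BGS.NPRel_oracleA_subset`); with the abstract enumeration from countability this gives
`∃ A, P^A = NP^A` (`exists_oracle_PRel_eq_NPRel`), but not the recursiveness of `A` asserted by
Baker–Gill–Solovay (1975), Thm. 1, and by the tree's named fact `baker_gill_solovay_eq`
(`StructuralPH.lean`: `∃ A, ComputablePred (· ∈ A) ∧ P^A = NP^A`).

This file proves that `BGS.oracleA e` is **primitive recursive** (`BGS.primrecPred_mem_oracleA`),
hence recursive in Mathlib's sense (`ComputablePred`, `BGS.computablePred_mem_oracleA`), whenever
the enumeration is *uniformly* primitive recursive — `(i, x, answers) ↦ (e i).step x answers` is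
`Primrec` — and concludes, with the uniformly primitive recursive enumeration `UnivTM2.stdEnum`
of `OracleAlgEnumeration.lean` (clocked standard machines run by the interpreter of
`UniversalTM2.lean`), the recursive form of the first half of the Baker–Gill–Solovay theorem:
`BGS.exists_computable_oracle_PRel_eq_NPRel : ∃ A, ComputablePred (· ∈ A) ∧ P^A = NP^A`.

The computation follows the recursion on lengths defining `A` literally:

* `BGS.runB` — the output of `e i` within `t` rounds against a FINITE oracle table (a list of
  strings), by iterating rounds (`BGS.roundB`); it is `OracleAlg.run` against the oracle of the
  table (`BGS.runB_eq`);
* `BGS.holdsB` — deciding membership of a string in `K(S)` for a finite table `S`: split the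
  string into the constituents of a code `⟨1^i, ⟨1^k, ⟨1^t, x⟩⟩⟩` (`BGS.dec3`, by `boolUnpair`),
  check that it is that code, and search the `2^{k+1} - 1` witnesses `w`, `|w| ≤ k`
  (`BGS.strsLe`) for an accepting run on `⟨x, w⟩` (`BGS.holdsB_eq_true_iff`);
* `BGS.belowList e n` — the table of the strings of `A` of length `< n`, by primitive recursion
  on `n` (`BGS.langOf_belowList : langOf (belowList e n) = below e n`), so that
  `c ∈ A ↔ c ∈ belowList e (|c| + 1)` (`BGS.mem_oracleA_iff_mem_belowList`);
* everything is `Primrec` by Mathlib's closure properties (`Primrec.nat_iterate`, `nat_rec₁`,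
  `list_foldr`, `PrimrecRel.listFilter`, `option_casesOn`, `sumCasesOn`) from the uniformity
  hypothesis and `MetaComplexity.primrec_boolUnpair`.

## References

* T. Baker, J. Gill, R. Solovay, *Relativizations of the P =? NP question*, SIAM J. Comput. 4
  (1975) 431–442, Thm. 1 (a recursive `A` with `P^A = NP^A`) [BakerGillSolovay1975] — full text
  not held (doi:10.1137/0204037, acquisition requested); the recursive/decidable form of the
  statement is confirmed from Homer–Selman, Thms. 7.18–7.19.
* S. Homer, A. L. Selman, *Computability and Complexity Theory*, 2nd ed., Springer 2011,
  §7.5.1.1 "Oracles for the P =? NP question", Thm. 7.18 (`NP^A = P^A` for a PSPACE-complete,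
  hence decidable, `A`), Thm. 7.19 ("there exists a decidable set `A` such that `NP^A ≠ P^A`")
  [HomerSelman2011].
* K.-I Ko, *Constructing oracles by lower bound techniques for circuits*, in: Combinatorics,
  Computing and Complexity (Kluwer, 1989), §5, p. 21 (the `NP(A)`-complete set `K(A)`) [Ko1989].
* S. Arora, B. Barak, *Computational Complexity: A Modern Approach*, CUP 2009, §3.4, Thm. 3.7
  [AroraBarakCC2009].
-/

namespace Literature.Computability.Complexity

namespace BGS

open _root_.Computability Encodable Function

variable (e : ℕ → OracleAlg Bool)

/-! ### Finite oracle tables -/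

/-- The language of a finite table of strings. [folklore] -/
def langOf (Sl : List (List Bool)) : Set (List Bool) := {q | q ∈ Sl}

/-- Membership in the language of a table. [folklore] -/
@[simp] theorem mem_langOf {Sl : List (List Bool)} {q : List Bool} : q ∈ langOf Sl ↔ q ∈ Sl := Iff.rfl

/-- The oracle of a finite table answers with the membership bit. [folklore] -/
theorem ofLanguage_langOf (Sl : List (List Bool)) (q : List Bool) :
    Oracle.ofLanguage (langOf Sl) q = [decide (q ∈ Sl)] := by
  rw [Oracle.ofLanguage_apply]
  by_cases h : q ∈ Sl <;> simp [Set.boolIndicator, langOf, h, encodeBool]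

/-- Membership in a finite table of strings is primitive recursive. [folklore] -/
theorem primrecRel_mem : PrimrecRel (fun (q : List Bool) (l : List (List Bool)) => q ∈ l) :=
  have h := Primrec.nat_lt.comp
    (Primrec.list_idxOf.comp (Primrec.fst (α := List Bool) (β := List (List Bool))) Primrec.snd)
    (Primrec.list_length.comp (Primrec.snd (α := List Bool) (β := List (List Bool))))
  h.of_eq fun _ => @List.idxOf_lt_length_iff _ instBEqOfDecidableEq inferInstance _ _

/-! ### Runs against a finite oracle table -/

/-- One round of the oracle algorithm `e i` on input `z` against the table `Sl`, on the state
(answers so far, output if any): once an output is produced the state is frozen.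
[cite: AroraBarakCC2009, §3.4] -/
def roundB (i : ℕ) (Sl : List (List Bool)) (z : List Bool) (st : List (List Bool) × Option Bool) :
    List (List Bool) × Option Bool :=
  match st.2 with
  | some b => (st.1, some b)
  | none =>
    match (e i).step z st.1 with
    | Sum.inl q => (st.1 ++ [[decide (q ∈ Sl)]], none)
    | Sum.inr b => (st.1, some b)

/-- The output of `e i` on `z` within `t` rounds against the table `Sl`, by iterating rounds.
[cite: AroraBarakCC2009, §3.4] -/
def runB (i : ℕ) (Sl : List (List Bool)) (t : ℕ) (z : List Bool) : Option Bool :=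
  ((roundB e i Sl z)^[t] ([], none)).2

/-- Iterated rounds compute `OracleAlg.runAux` against the oracle of the table. [cite: AroraBarakCC2009, §3.4] -/
theorem iterate_roundB (i : ℕ) (Sl : List (List Bool)) (z : List Bool) :
    ∀ (t : ℕ) (as : List (List Bool)),
      ((roundB e i Sl z)^[t] (as, none)).2 = (e i).runAux (Oracle.ofLanguage (langOf Sl)) z t as
  | 0, as => rfl
  | t + 1, as => by
    rw [iterate_succ_apply, OracleAlg.runAux_succ]
    have h1 : roundB e i Sl z (as, none) =
        (match (e i).step z as with
          | Sum.inl q => (as ++ [[decide (q ∈ Sl)]], none)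
          | Sum.inr b => (as, some b)) := rfl
    rw [h1]
    cases (e i).step z as with
    | inl q =>
      simp only
      rw [iterate_roundB i Sl z t, ofLanguage_langOf]
    | inr b =>
      simp only
      rw [iterate_fixed (rfl : roundB e i Sl z (as, some b) = (as, some b))]

/-- `runB` computes `OracleAlg.run` against the oracle of the table. [cite: AroraBarakCC2009, §3.4] -/
theorem runB_eq (i : ℕ) (Sl : List (List Bool)) (t : ℕ) (z : List Bool) :
    runB e i Sl t z = (e i).run (Oracle.ofLanguage (langOf Sl)) t z :=
  iterate_roundB e i Sl z t []

/-! ### Enumerating strings -/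

/-- All strings of a given length. [folklore] -/
def strsLen : ℕ → List (List Bool)
  | 0 => [[]]
  | n + 1 => (strsLen n).flatMap fun w => [false :: w, true :: w]

/-- `strsLen n` lists exactly the strings of length `n`. [folklore] -/
theorem mem_strsLen : ∀ {n : ℕ} {w : List Bool}, w ∈ strsLen n ↔ w.length = n
  | 0, w => by simp [strsLen, List.length_eq_zero_iff]
  | n + 1, w => by
    simp only [strsLen, List.mem_flatMap, List.mem_cons, List.not_mem_nil, or_false]
    constructor
    · rintro ⟨w', hw', rfl | rfl⟩ <;> simp [mem_strsLen.1 hw']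
    · intro h
      cases w with
      | nil => simp at h
      | cons b w =>
        refine ⟨w, mem_strsLen.2 (by simpa using h), ?_⟩
        cases b <;> simp

/-- All strings of length at most `k`. [folklore] -/
def strsLe (k : ℕ) : List (List Bool) := (List.range (k + 1)).flatMap strsLen

/-- `strsLe k` lists exactly the strings of length `≤ k`. [folklore] -/
theorem mem_strsLe {k : ℕ} {w : List Bool} : w ∈ strsLe k ↔ w.length ≤ k := by
  simp only [strsLe, List.mem_flatMap, List.mem_range, mem_strsLen]
  constructor
  · rintro ⟨n, hn, h⟩; omega
  · intro h; exact ⟨w.length, by omega, rfl⟩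

/-- `strsLen` is primitive recursive. [folklore] -/
theorem primrec_strsLen : Primrec strsLen := by
  have h : Primrec (fun n : ℕ => Nat.rec (motive := fun _ => List (List Bool)) [[]]
      (fun _ IH => IH.flatMap fun w => [false :: w, true :: w]) n) := by
    refine Primrec.nat_rec₁ _ ?_
    have h2 : Primrec (fun q : (ℕ × List (List Bool)) × List Bool => [false :: q.2, true :: q.2]) :=
      Primrec.list_cons.comp (Primrec.list_cons.comp (Primrec.const false) Primrec.snd)
        (Primrec.list_cons.comp (Primrec.list_cons.comp (Primrec.const true) Primrec.snd) (Primrec.const []))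
    have h1 : Primrec (fun p : ℕ × List (List Bool) => p.2.flatMap fun w => [false :: w, true :: w]) :=
      Primrec.list_flatMap Primrec.snd h2.to₂
    exact h1.to₂
  refine h.of_eq fun n => ?_
  induction n with
  | zero => rfl
  | succ n ih => simp only [strsLen, ← ih]

/-- `strsLe` is primitive recursive. [folklore] -/
theorem primrec_strsLe : Primrec strsLe :=
  Primrec.list_flatMap (Primrec.list_range.comp Primrec.succ) (primrec_strsLen.comp Primrec.snd).to₂

/-! ### Deciding `Holds` against a finite table -/

/-- Splitting a string into the four constituents of a code `⟨1^i, ⟨1^k, ⟨1^t, x⟩⟩⟩`. [cite: Ko1989, §5 (p. 21)] -/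
def dec3 (c : List Bool) : List Bool × List Bool × List Bool × List Bool :=
  ((boolUnpair c).1, (boolUnpair (boolUnpair c).2).1, (boolUnpair (boolUnpair (boolUnpair c).2).2).1,
    (boolUnpair (boolUnpair (boolUnpair c).2).2).2)

/-- Splitting a code recovers its constituents. [cite: Ko1989, §5 (p. 21)] -/
theorem dec3_code (i k t : ℕ) (x : List Bool) : dec3 (code i k t x) = (ones i, ones k, ones t, x) := by
  simp [dec3, code]

/-- `dec3` is primitive recursive (three `boolUnpair`s). [folklore] -/
theorem primrec_dec3 : Primrec dec3 := by
  have hu := MetaComplexity.primrec_boolUnpair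
  have h1 : Primrec fun c : List Bool => (boolUnpair c).2 := Primrec.snd.comp hu
  have h2 : Primrec fun c : List Bool => (boolUnpair (boolUnpair c).2).2 := Primrec.snd.comp (hu.comp h1)
  unfold dec3
  exact Primrec.pair (Primrec.fst.comp hu) (Primrec.pair (Primrec.fst.comp (hu.comp h1))
    (Primrec.pair (Primrec.fst.comp (hu.comp h2)) (Primrec.snd.comp (hu.comp h2))))

/-- Searching the witnesses: does some `w ∈ ws` make `e i` accept `⟨x, w⟩` within `t` rounds
against the table? [cite: Ko1989, §5 (p. 21)] -/
def witB (i : ℕ) (Sl : List (List Bool)) (t : ℕ) (x : List Bool) (ws : List (List Bool)) : Bool :=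
  ws.foldr (fun w acc => decide (runB e i Sl t (boolPair x w) = some true) || acc) false

/-- The witness search succeeds iff some listed witness is accepted. [cite: Ko1989, §5 (p. 21)] -/
theorem witB_eq_true {i : ℕ} {Sl : List (List Bool)} {t : ℕ} {x : List Bool} :
    ∀ {ws : List (List Bool)}, witB e i Sl t x ws = true ↔ ∃ w ∈ ws, runB e i Sl t (boolPair x w) = some true
  | [] => by simp [witB]
  | w :: ws => by
    have ih := witB_eq_true (i := i) (Sl := Sl) (t := t) (x := x) (ws := ws)
    simp only [witB, List.foldr_cons, Bool.or_eq_true, decide_eq_true_eq, List.mem_cons, exists_eq_or_imp] at ih ⊢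
    rw [ih]

/-- **Deciding membership in `K(S)` for a finite table `S`**: the string is a code
`⟨1^i, ⟨1^k, ⟨1^t, x⟩⟩⟩` and some witness of length `≤ k` is accepted. [cite: Ko1989, §5 (p. 21)] -/
def holdsB (Sl : List (List Bool)) (c : List Bool) : Bool :=
  decide (c = code (dec3 c).1.length (dec3 c).2.1.length (dec3 c).2.2.1.length (dec3 c).2.2.2) &&
    witB e (dec3 c).1.length Sl (dec3 c).2.2.1.length (dec3 c).2.2.2 (strsLe (dec3 c).2.1.length)

/-- `holdsB` decides `Holds` against the language of the table. [cite: Ko1989, §5 (p. 21)] -/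
theorem holdsB_eq_true_iff (Sl : List (List Bool)) (c : List Bool) :
    holdsB e Sl c = true ↔ Holds e (langOf Sl) c := by
  simp only [holdsB, Bool.and_eq_true, decide_eq_true_eq, witB_eq_true, mem_strsLe, runB_eq]
  constructor
  · rintro ⟨hc, w, hw, hrun⟩
    exact ⟨_, _, _, _, hc, w, hw, hrun⟩
  · rintro ⟨i, k, t, x, rfl, w, hw, hrun⟩
    refine ⟨?_, w, ?_, ?_⟩
    · simp [dec3_code]
    · simpa [dec3_code] using hw
    · simpa [dec3_code] using hrun

/-! ### The oracle below a given length, as a table -/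

/-- The finite table of the strings of `A` of length `< n` (the stage `below e n`), computed
by the recursion defining `A = K(A)`. [cite: Ko1989, §5 (p. 21)] -/
def belowList : ℕ → List (List Bool)
  | 0 => []
  | n + 1 => belowList n ++ (strsLen n).filter (holdsB e (belowList n))

/-- The table enumerates the stage. [cite: Ko1989, §5 (p. 21)] -/
theorem langOf_belowList : ∀ n : ℕ, langOf (belowList e n) = below e n
  | 0 => by ext c; simp [langOf, belowList, below]
  | n + 1 => by
    ext c
    have ih := langOf_belowList n
    simp only [mem_langOf, belowList, List.mem_append, List.mem_filter, mem_strsLen, below, Set.mem_union,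
      Set.mem_setOf_eq, holdsB_eq_true_iff, ih]
    rw [← mem_langOf, ih]

/-- **Membership in the collapsing oracle is a table lookup.** [cite: Ko1989, §5 (p. 21)] -/
theorem mem_oracleA_iff_mem_belowList (c : List Bool) : c ∈ oracleA e ↔ c ∈ belowList e (c.length + 1) := by
  rw [← mem_langOf, langOf_belowList]
  rfl

/-! ### Primitive recursiveness -/

section Primrec

variable {e}
variable (he : Primrec (fun p : ℕ × List Bool × List (List Bool) => (e p.1).step p.2.1 p.2.2))
include he

/-- One round is primitive recursive, uniformly (composed form). [cite: AroraBarakCC2009, §3.4] -/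
theorem primrec_roundB {α : Type} [Primcodable α] {i : α → ℕ} {Sl : α → List (List Bool)} {z : α → List Bool}
    {st : α → List (List Bool) × Option Bool} (hi : Primrec i) (hSl : Primrec Sl) (hz : Primrec z)
    (hst : Primrec st) : Primrec fun a => roundB e (i a) (Sl a) (z a) (st a) := by
  have hstep : Primrec fun a => (e (i a)).step (z a) (st a).1 :=
    he.comp (Primrec.pair hi (Primrec.pair hz (Primrec.fst.comp hst)))
  have hq : Primrec fun p : α × List Bool => ((st p.1).1 ++ [[decide (p.2 ∈ Sl p.1)]], (none : Option Bool)) := by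
    refine Primrec.pair (Primrec.list_append.comp (Primrec.fst.comp (hst.comp Primrec.fst)) ?_) (Primrec.const none)
    refine Primrec.list_cons.comp ?_ (Primrec.const [])
    refine Primrec.list_cons.comp ?_ (Primrec.const [])
    exact (primrecRel_mem.comp Primrec.snd (hSl.comp Primrec.fst)).decide
  have hb : Primrec fun p : α × Bool => ((st p.1).1, some p.2) :=
    Primrec.pair (Primrec.fst.comp (hst.comp Primrec.fst)) (Primrec.option_some.comp Primrec.snd)
  have H : Primrec fun a => Option.casesOn (motive := fun _ => List (List Bool) × Option Bool) (st a).2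
      (Sum.casesOn (motive := fun _ => List (List Bool) × Option Bool) ((e (i a)).step (z a) (st a).1)
        (fun q => ((st a).1 ++ [[decide (q ∈ Sl a)]], none)) (fun b => ((st a).1, some b)))
      (fun b => ((st a).1, some b)) :=
    Primrec.option_casesOn (Primrec.snd.comp hst) (Primrec.sumCasesOn hstep hq.to₂ hb.to₂) hb.to₂
  refine H.of_eq fun a => ?_
  simp only [roundB]
  rcases st a with ⟨as, _ | b⟩
  · simp only
    cases (e (i a)).step (z a) as <;> rfl
  · rfl

/-- Runs against a table are primitive recursive, uniformly (composed form). [cite: AroraBarakCC2009, §3.4] -/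
theorem primrec_runB {α : Type} [Primcodable α] {i : α → ℕ} {Sl : α → List (List Bool)} {t : α → ℕ}
    {z : α → List Bool} (hi : Primrec i) (hSl : Primrec Sl) (ht : Primrec t) (hz : Primrec z) :
    Primrec fun a => runB e (i a) (Sl a) (t a) (z a) := by
  unfold runB
  refine Primrec.snd.comp (Primrec.nat_iterate ht (Primrec.const ([], none)) ?_)
  exact (primrec_roundB he (hi.comp Primrec.fst) (hSl.comp Primrec.fst) (hz.comp Primrec.fst) Primrec.snd).to₂

/-- The witness search is primitive recursive (composed form). [cite: Ko1989, §5 (p. 21)] -/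
theorem primrec_witB {α : Type} [Primcodable α] {i : α → ℕ} {Sl : α → List (List Bool)} {t : α → ℕ}
    {x : α → List Bool} {ws : α → List (List Bool)} (hi : Primrec i) (hSl : Primrec Sl) (ht : Primrec t)
    (hx : Primrec x) (hws : Primrec ws) : Primrec fun a => witB e (i a) (Sl a) (t a) (x a) (ws a) := by
  unfold witB
  have hh : Primrec fun p : α × (List Bool × Bool) =>
      decide (runB e (i p.1) (Sl p.1) (t p.1) (boolPair (x p.1) p.2.1) = some true) || p.2.2 := by
    refine Primrec.or.comp ?_ (Primrec.snd.comp Primrec.snd)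
    refine PrimrecPred.decide (Primrec.eq.comp ?_ (Primrec.const (some true)))
    exact primrec_runB he (hi.comp Primrec.fst) (hSl.comp Primrec.fst) (ht.comp Primrec.fst)
      (UnivTM2.primrec_boolPair.comp (hx.comp Primrec.fst) (Primrec.fst.comp Primrec.snd))
  exact Primrec.list_foldr hws (Primrec.const false) hh.to₂

/-- Deciding `K(S)` for finite tables `S` is primitive recursive. [cite: Ko1989, §5 (p. 21)] -/
theorem primrec_holdsB : Primrec₂ (holdsB e) := by
  have hd : Primrec fun p : List (List Bool) × List Bool => dec3 p.2 := primrec_dec3.comp Primrec.snd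
  have hi : Primrec fun p : List (List Bool) × List Bool => (dec3 p.2).1.length :=
    Primrec.list_length.comp (Primrec.fst.comp hd)
  have hk : Primrec fun p : List (List Bool) × List Bool => (dec3 p.2).2.1.length :=
    Primrec.list_length.comp (Primrec.fst.comp (Primrec.snd.comp hd))
  have ht : Primrec fun p : List (List Bool) × List Bool => (dec3 p.2).2.2.1.length :=
    Primrec.list_length.comp (Primrec.fst.comp (Primrec.snd.comp (Primrec.snd.comp hd)))
  have hx : Primrec fun p : List (List Bool) × List Bool => (dec3 p.2).2.2.2 :=
    Primrec.snd.comp (Primrec.snd.comp (Primrec.snd.comp hd))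
  have hcode : Primrec fun p : List (List Bool) × List Bool =>
      code (dec3 p.2).1.length (dec3 p.2).2.1.length (dec3 p.2).2.2.1.length (dec3 p.2).2.2.2 := by
    unfold code
    have hones : Primrec ones := by
      have h : Primrec (fun n : ℕ => (List.cons true)^[n] ([] : List Bool)) :=
        Primrec.nat_iterate Primrec.id (Primrec.const [])
          ((Primrec.list_cons.comp (Primrec.const true) Primrec.snd).to₂)
      refine h.of_eq fun n => ?_
      induction n with
      | zero => rfl
      | succ n ih => rw [iterate_succ_apply', ih]; rfl
    exact UnivTM2.primrec_boolPair.comp (hones.comp hi) (UnivTM2.primrec_boolPair.comp (hones.comp hk)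
      (UnivTM2.primrec_boolPair.comp (hones.comp ht) hx))
  unfold holdsB
  refine Primrec₂.mk (Primrec.and.comp (PrimrecPred.decide (Primrec.eq.comp Primrec.snd hcode)) ?_)
  exact primrec_witB he hi Primrec.fst ht hx (primrec_strsLe.comp hk)

/-- The table of the oracle below a length is primitive recursive in the length. [cite: Ko1989, §5 (p. 21)] -/
theorem primrec_belowList : Primrec (belowList e) := by
  have hf : Primrec₂ fun (n : ℕ) (IH : List (List Bool)) =>
      IH ++ (strsLen n).filter (fun c => decide (holdsB e IH c = true)) := by
    refine Primrec₂.mk (Primrec.list_append.comp Primrec.snd ?_)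
    have hR : PrimrecRel fun (c : List Bool) (IH : List (List Bool)) => holdsB e IH c = true :=
      Primrec.eq.comp ((primrec_holdsB he).comp Primrec.snd Primrec.fst) (Primrec.const true)
    exact hR.listFilter.comp (primrec_strsLen.comp Primrec.fst) Primrec.snd
  have h := Primrec.nat_rec₁ ([] : List (List Bool)) hf
  refine h.of_eq fun n => ?_
  induction n with
  | zero => rfl
  | succ n ih =>
    simp only [belowList, ← ih, Bool.decide_eq_true]

/-- **The collapsing oracle is primitive recursive** for a uniformly primitive recursive
enumeration. [cite: BakerGillSolovay1975, Thm. 1 (recursiveness of the oracle)] [cite: Ko1989, §5 (p. 21)] -/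
theorem primrecPred_mem_oracleA : PrimrecPred fun c => c ∈ oracleA e := by
  have h : PrimrecPred fun c : List Bool => c ∈ belowList e (c.length + 1) :=
    primrecRel_mem.comp Primrec.id ((primrec_belowList he).comp (Primrec.succ.comp Primrec.list_length))
  exact h.of_eq fun c => (mem_oracleA_iff_mem_belowList e c).symm

/-- **The collapsing oracle is recursive** (Mathlib's `ComputablePred`) for a uniformly primitive
recursive enumeration. [cite: BakerGillSolovay1975, Thm. 1] -/
theorem computablePred_mem_oracleA : ComputablePred fun c => c ∈ oracleA e := by
  obtain ⟨inst, h⟩ := primrecPred_mem_oracleA he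
  exact ⟨inst, h.to_comp⟩

end Primrec

/-! ### The recursive collapsing oracle -/

/-- **Baker–Gill–Solovay, first half, with a recursive oracle** (Baker–Gill–Solovay 1975,
Thm. 1; Homer–Selman 2011, Thm. 7.18): there is a *recursive* oracle `A ⊆ {0,1}*` with
`P^A = NP^A` — namely `A = K(A)` over the standard enumeration `UnivTM2.stdEnum`, which contains
every polynomial-time oracle algorithm (`UnivTM2.isPolyTime_subset_range_stdEnum`, so
`NP^A ⊆ P^A` by `NPRel_oracleA_subset`) and is uniformly primitive recursive
(`UnivTM2.primrec_stdEnum_step`, so `A` is recursive by `computablePred_mem_oracleA`). This is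
verbatim the body of the named fact `baker_gill_solovay_eq` (`StructuralPH.lean`).
[cite: BakerGillSolovay1975, Thm. 1] [cite: HomerSelman2011, Thm. 7.18] -/
theorem exists_computable_oracle_PRel_eq_NPRel :
    ∃ A : Language Bool, ComputablePred (· ∈ A) ∧
      PRel (Oracle.ofLanguage A) = NPRel (Oracle.ofLanguage A) :=
  ⟨oracleA UnivTM2.stdEnum, computablePred_mem_oracleA UnivTM2.primrec_stdEnum_step,
    PRel_eq_NPRel_of_subset (NPRel_oracleA_subset _ UnivTM2.isPolyTime_subset_range_stdEnum)⟩

end BGS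

end Literature.Computability.Complexity
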